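import Summits.Ventures.CertifiedManyBodySolver.Theorems.TcThermcert1GcFugacityNormalization
import Summits.HubbardSuperconductivity.HubbardLadder.Bounds.TwistedFluxCoupling
import Mathlib
import HarnessLib

/-!
# The two-fugacity twisted trace as ONE exponential, and its atomic limit (K2 groundwork, part 1)

Helper file for route `TcThermcert1`, crux `ThermalStiffnessCeilingU8b10_le_1o8` (item `stmt-Ventures-26381`), line
`Cruxes/ThermalStiffnessCeilingU8b10_le_1o8/Lines/zerofree_corridor.lean` v9, registered stub K2 `stub_gcHighTempAnalytic`, steps S1–S2 of
`Cruxes/…/STUB-PLAN-stub_gcHighTempAnalytic.md`: K2's object `tr( diag(ζ↑^{N↑} ζ↓^{N↓}) e^{−βH^{tt′}_L(θ)} )` (complex `β`, two complex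
fugacities) is put into the shape on which the tree's polymer technology (`Literature…HubbardBondAlgebra.Zc`, cell pub-hubbard
`Bounds/CouplingPolymerGas`, `Bounds/ComplexFugacity*`) operates — the trace of a single exponential `exp(−βV_Λ + D + Σ_b c_b T_b)` with a
diagonal one-site part — and its coupling-free reference value is computed.

* §1 (generic `Λ`, any `H` with `PreservesSectors H`): `diagonal_fugacity_eq_exp` — `diag(z^{#↑s} w^{#↓s}) = exp(diag(#↑s·log z + #↓s·log w))`
  for `z, w ≠ 0`; `commute_smul_logFugacity_diagonal`; `trace_diagonal_fugacity_mul_exp_eq` —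
  `tr(diag(z^{N↑}w^{N↓}) e^{−βH}) = tr exp(−βH + diag(#↑·log z + #↓·log w))` (`[H, N_σ] = 0`, `Matrix.exp_add_of_commute`, cyclicity).
* §2 (the `t–t′` seam-flux torus, `L ≥ 3`, COMPLEX `β`): `hubbardTorusTT'Flux_eq_onSiteSum_sub_hopSum` —
  `H^{tt′}_L(t′,U;θ) = V_Λ(U,0) − Σ_b c₁(b) T_b`,
  `c₁ = ttFluxCoupling L 1 t′ θ` (operator form of the landed real-`β` dictionary `Bounds/TwistedFluxCoupling.neg_smul_hubbardTorusTT'FluxMu_eq`);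
  `neg_smul_hubbardTorusTT'Flux_eq` — `−βH = −βV_Λ(U,0) + Σ_b (β c₁(b)) T_b` for complex `β` (`hopSum_smul`); `gcTwist_trace_eq_trace_exp` — K2's
  trace `= tr exp(−βV_Λ(U,0) + diag(#↑·log ζ↑ + #↓·log ζ↓) + Σ_b (β c₁(b)) T_b)` for `ζ↑, ζ↓ ≠ 0` (`ne_zero_of_mem_annulus`: automatic on
  the annulus).
* §3 (generic `Λ`): the two-fugacity atomic limit `tr(diag(z^{N↑}w^{N↓}) e^{−βV_Λ(U,0)}) = (1 + z + w + zw·e^{−βU})^{#Λ}` for ALL complex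
  `β, U, z, w` (`trace_diagonal_fugacity_mul_exp_neg_onSiteSum`; one-site table `(1, z, w, zw e^{−βU})`, pattern of the tree's
  `trace_exp_neg_onSiteSum`), and its fused form `trace_exp_neg_onSiteSum_add_logFugacity` (`= Zc₂(c = 0)`, the reference of the port's
  polymer representation); `preservesSectors_diagonal`, `preservesSectors_onSiteSum`.

Lemmas quantify over an arbitrary `DecidableEq` instance on configurations where the line's definitions synthesise their own
(as in `TcThermcert1FugacityProjection.lean`). [folklore] Finite-dimensional linear algebra; no physics claim — nothing about
superconductivity in the Hubbard model is proved by anything in this file. No definitions; no `sorry`.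
-/

noncomputable section

namespace Summit.Ventures.CertifiedManyBodySolver.Theorems.TcThermcert1.ZeroFreeCorridor

open Matrix Finset Complex
open Literature.MathematicalPhysics.QuantumLattice
open Summit.HubbardSuperconductivity.HubbardLadder.Bounds

/-! ## §1 The fugacity diagonal as an exponential; fusing it with `e^{−βH}` -/

section Generic

variable {Λ : Type*} [LinearOrder Λ] [Fintype Λ]

omit [LinearOrder Λ] [Fintype Λ] in
/-- For `z ≠ 0`: `z^n = e^{n log z}`. -/
theorem pow_eq_cexp_nat_mul_log {z : ℂ} (hz : z ≠ 0) (n : ℕ) : z ^ n = cexp ((n : ℂ) * Complex.log z) := by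
  rw [Complex.exp_nat_mul, Complex.exp_log hz]

/-- **The fugacity diagonal is an exponential**: for `z, w ≠ 0`, `diag(z^{#↑s} w^{#↓s}) = exp(diag(#↑s·log z + #↓s·log w))`. -/
theorem diagonal_fugacity_eq_exp {inst : DecidableEq (Finset (Orb Λ))} {z w : ℂ} (hz : z ≠ 0) (hw : w ≠ 0) :
    @diagonal _ ℂ inst _ (fun s : Finset (Orb Λ) => z ^ (upPart s).card * w ^ (downPart s).card) =
      NormedSpace.exp (@diagonal _ ℂ inst _ fun s : Finset (Orb Λ) =>
        ((upPart s).card : ℂ) * Complex.log z + ((downPart s).card : ℂ) * Complex.log w) := by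
  rw [Matrix.exp_diagonal]
  congr 1
  funext s
  rw [Pi.exp_def]
  dsimp only
  rw [← Complex.exp_eq_exp_ℂ, Complex.exp_add, ← pow_eq_cexp_nat_mul_log hz, ← pow_eq_cexp_nat_mul_log hw]

/-- A sector-preserving `H` commutes with the log-fugacity diagonal (it conserves `N↑` and `N↓`). -/
theorem commute_smul_logFugacity_diagonal {inst : DecidableEq (Finset (Orb Λ))} (H : Matrix (Finset (Orb Λ)) (Finset (Orb Λ)) ℂ)
    (hH : PreservesSectors H) (β z w : ℂ) :
    Commute (-β • H) (@diagonal _ ℂ inst _ fun s : Finset (Orb Λ) =>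
      ((upPart s).card : ℂ) * Complex.log z + ((downPart s).card : ℂ) * Complex.log w) := by
  convert (hH.commute_diagonal fun a b => (a : ℂ) * Complex.log z + (b : ℂ) * Complex.log w).smul_left (-β) using 3

/-- **Fusing the fugacities into the exponent.** For `H` conserving `N↑, N↓` and `z, w ≠ 0`:
`tr( diag(z^{N↑} w^{N↓}) · e^{−βH} ) = tr exp( −βH + diag(#↑·log z + #↓·log w) )` — the two-fugacity twisted trace is the trace of ONE
exponential, i.e. a generalised Gibbs factor with a spin-dependent (complex) chemical potential `βμ_σ = log ζ_σ`. -/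
theorem trace_diagonal_fugacity_mul_exp_eq {inst : DecidableEq (Finset (Orb Λ))} (H : Matrix (Finset (Orb Λ)) (Finset (Orb Λ)) ℂ)
    (hH : PreservesSectors H) (β : ℂ) {z w : ℂ} (hz : z ≠ 0) (hw : w ≠ 0) :
    (@diagonal _ ℂ inst _ (fun s : Finset (Orb Λ) => z ^ (upPart s).card * w ^ (downPart s).card) * NormedSpace.exp (-β • H)).trace =
      (NormedSpace.exp (-β • H + @diagonal _ ℂ inst _ fun s : Finset (Orb Λ) =>
        ((upPart s).card : ℂ) * Complex.log z + ((downPart s).card : ℂ) * Complex.log w)).trace := by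
  rw [Matrix.exp_add_of_commute _ _ (commute_smul_logFugacity_diagonal H hH β z w), diagonal_fugacity_eq_exp hz hw,
    Matrix.trace_mul_comm]

end Generic

/-! ## §2 The `t–t′` seam-flux torus at complex `β`: the exponent in bond-algebra form -/

section Torus

variable (L : ℕ) [NeZero L]

/-- `hopSum` is homogeneous: `Σ_b (a c_b) T_b = a • Σ_b c_b T_b`. -/
theorem hopSum_smul {Λ : Type*} [LinearOrder Λ] [Fintype Λ] (a : ℂ) (c : Bond Λ → ℂ) : hopSum (a • c) = a • hopSum c := by
  unfold hopSum
  rw [Finset.smul_sum]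
  exact Finset.sum_congr rfl fun b _ => by rw [Pi.smul_apply, smul_eq_mul, mul_smul]

/-- **The `t–t′` flux torus in Ueltschi's bond algebra** (operator form of the landed dictionary
`neg_smul_hubbardTorusTT'FluxMu_eq` at `β = 1`, `μ = 0`): `H^{tt′}_L(t′,U;θ) = V_Λ(U, 0) − Σ_b c₁(b) T_b`,
`c₁ = ttFluxCoupling L 1 t′ θ` (`L ≥ 3`). -/
theorem hubbardTorusTT'Flux_eq_onSiteSum_sub_hopSum (hL : 3 ≤ L) (tp U θ : ℝ) :
    hubbardTorusTT'Flux L tp U θ = onSiteSum (U : ℂ) 0 (Finset.univ : Finset (FermionTorus 2 L)) - hopSum (ttFluxCoupling L 1 tp θ) := by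
  have h := neg_smul_hubbardTorusTT'FluxMu_eq (L := L) hL 1 tp U 0 θ
  simp only [Complex.ofReal_one, Complex.ofReal_zero, zero_smul, sub_zero, one_smul, neg_smul] at h
  have h' := congrArg Neg.neg h
  simp only [neg_neg, neg_add, ← sub_eq_add_neg] at h'
  exact h'

/-- **The exponent at COMPLEX `β`**: `−β H^{tt′}_L(θ) = −β V_Λ(U,0) + Σ_b (β c₁(b)) T_b`. -/
theorem neg_smul_hubbardTorusTT'Flux_eq (hL : 3 ≤ L) (tp U θ : ℝ) (β : ℂ) :
    -β • hubbardTorusTT'Flux L tp U θ =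
      -(β • onSiteSum (U : ℂ) 0 (Finset.univ : Finset (FermionTorus 2 L))) + hopSum (β • ttFluxCoupling L 1 tp θ) := by
  rw [hubbardTorusTT'Flux_eq_onSiteSum_sub_hopSum L hL, hopSum_smul, smul_sub, neg_smul, neg_smul, sub_neg_eq_add]

/-- **K2's trace as a two-fugacity generalised Gibbs factor.** For `L ≥ 3`, real `t′, U, θ`, complex `β` and fugacities `ζ↑, ζ↓ ≠ 0`:
`tr( diag(ζ↑^{N↑} ζ↓^{N↓}) e^{−βH^{tt′}_L(θ)} ) = tr exp( −β V_Λ(U,0) + diag(#↑·log ζ↑ + #↓·log ζ↓) + Σ_b (β c₁(b)) T_b )`. -/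
theorem gcTwist_trace_eq_trace_exp (hL : 3 ≤ L) (tp U θ : ℝ) (β : ℂ) {ζu ζd : ℂ} (hu : ζu ≠ 0) (hd : ζd ≠ 0) :
    (diagonal (fun s : Finset (Orb (FermionTorus 2 L)) => ζu ^ (upPart s).card * ζd ^ (downPart s).card) *
        NormedSpace.exp (-β • hubbardTorusTT'Flux L tp U θ)).trace =
      (NormedSpace.exp (-(β • onSiteSum (U : ℂ) 0 (Finset.univ : Finset (FermionTorus 2 L))) +
        diagonal (fun s : Finset (Orb (FermionTorus 2 L)) =>
          ((upPart s).card : ℂ) * Complex.log ζu + ((downPart s).card : ℂ) * Complex.log ζd) +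
        hopSum (β • ttFluxCoupling L 1 tp θ))).trace := by
  rw [trace_diagonal_fugacity_mul_exp_eq _ (preservesSectors_hubbardTorusTT'Flux L tp U θ) β hu hd,
    neg_smul_hubbardTorusTT'Flux_eq L hL, add_right_comm]

/-- On the fugacity annulus `ζ ≠ 0`. -/
theorem ne_zero_of_mem_annulus {ζ : ℂ} (hζ : ζ ∈ {ζ : ℂ | 2 / 3 < ‖ζ‖ ∧ ‖ζ‖ < 8 / 9}) : ζ ≠ 0 := by
  rintro rfl
  have := hζ.1
  rw [norm_zero] at this
  linarith

end Torus


/-! ## §3 The two-fugacity atomic limit -/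

section Atomic

variable {Λ : Type*} [LinearOrder Λ] [Fintype Λ]

omit [LinearOrder Λ] in
/-- `∏_x [x ∈ A] z = z^{#A}`. -/
theorem prod_ite_mem_eq_pow [DecidableEq Λ] (A : Finset Λ) (z : ℂ) : (∏ x, if x ∈ A then z else 1) = z ^ A.card := by
  rw [Finset.prod_ite_mem, Finset.univ_inter, Finset.prod_const]

/-- A diagonal matrix preserves the `(N↑, N↓)` sectors. -/
theorem preservesSectors_diagonal {inst : DecidableEq (Finset (Orb Λ))} (d : Finset (Orb Λ) → ℂ) :
    PreservesSectors (@diagonal _ ℂ inst _ d) := by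
  intro s s' h
  by_cases hs : s = s'
  · subst hs; exact ⟨rfl, rfl⟩
  · exact absurd (diagonal_apply_ne d hs) h

/-- The on-site interaction `V_A(U, μ)` preserves the sectors (it is diagonal). -/
theorem preservesSectors_onSiteSum (U μ : ℂ) (A : Finset Λ) : PreservesSectors (onSiteSum U μ A) := by
  rw [onSiteSum_eq_diagonal]; exact preservesSectors_diagonal _

/-- The two-fugacity atomic limit with the canonical `DecidableEq` instance (see `trace_diagonal_fugacity_mul_exp_neg_onSiteSum`). -/
theorem trace_diagonal_fugacity_mul_exp_neg_onSiteSum_aux (β U z w : ℂ) :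
    (diagonal (fun s : Finset (Orb Λ) => z ^ (upPart s).card * w ^ (downPart s).card) *
        NormedSpace.exp (-(β • onSiteSum U 0 (Finset.univ : Finset Λ)))).trace =
      (1 + z + w + z * w * cexp (-(β * U))) ^ Fintype.card Λ := by
  rw [onSiteSum_eq_diagonal, show (-(β • diagonal fun s : Finset (Orb Λ) => ∑ x ∈ Finset.univ, onSiteEnergyAt U 0 x s)) =
      diagonal (fun s => -(β * ∑ x ∈ Finset.univ, onSiteEnergyAt U 0 x s)) by rw [← diagonal_smul, ← diagonal_neg]; rfl,
    Matrix.exp_diagonal, diagonal_mul_diagonal, trace_diagonal]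
  simp only [Pi.exp_def, ← Complex.exp_eq_exp_ℂ]
  simp_rw [exp_neg_sum_onSiteEnergyAt]
  simp only [Finset.mem_univ, if_true]
  -- reindex configurations by (up-set, down-set)
  have h := Fintype.sum_equiv (configEquiv (Λ := Λ))
    (fun s : Finset (Orb Λ) => z ^ (upPart s).card * w ^ (downPart s).card *
      ∏ x, atomicBoltzmannTable β U 0 (decide (x ∈ upPart s)) (decide (x ∈ downPart s)))
    (fun p : Finset Λ × Finset Λ => z ^ p.1.card * w ^ p.2.card *
      ∏ x, atomicBoltzmannTable β U 0 (decide (x ∈ p.1)) (decide (x ∈ p.2))) fun s => rfl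
  rw [h, Fintype.sum_prod_type]
  -- one factorised weight per site
  set φ : Λ → Bool → Bool → ℂ := fun _ b b' => (if b = true then z else 1) * (if b' = true then w else 1) * atomicBoltzmannTable β U 0 b b'
    with hφ
  have hterm : ∀ A B : Finset Λ, z ^ A.card * w ^ B.card * ∏ x, atomicBoltzmannTable β U 0 (decide (x ∈ A)) (decide (x ∈ B)) =
      ∏ x, φ x (decide (x ∈ A)) (decide (x ∈ B)) := by
    intro A B
    rw [← prod_ite_mem_eq_pow A z, ← prod_ite_mem_eq_pow B w, ← Finset.prod_mul_distrib, ← Finset.prod_mul_distrib]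
    refine Finset.prod_congr rfl fun x _ => ?_
    simp only [hφ, decide_eq_true_eq]
  simp_rw [hterm]
  rw [sum_sum_prod_eq_prod φ]
  simp only [hφ, atomicBoltzmannTable, if_true, Bool.false_eq_true, if_false, mul_zero, sub_zero, Complex.exp_zero, mul_one, one_mul,
    Finset.prod_const, Finset.card_univ]
  congr 1; ring

/-- **The two-fugacity atomic limit** (one-site table `(1, ζ↑, ζ↓, ζ↑ζ↓e^{−βU})`):
`tr( diag(z^{N↑} w^{N↓}) e^{−β V_Λ(U,0)} ) = (1 + z + w + z w e^{−βU})^{#Λ}` for all complex `β, U, z, w` (any `DecidableEq` instance on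
configurations, as synthesised at the use site). -/
theorem trace_diagonal_fugacity_mul_exp_neg_onSiteSum {inst : DecidableEq (Finset (Orb Λ))} (β U z w : ℂ) :
    (@diagonal _ ℂ inst _ (fun s : Finset (Orb Λ) => z ^ (upPart s).card * w ^ (downPart s).card) *
        NormedSpace.exp (-(β • onSiteSum U 0 (Finset.univ : Finset Λ)))).trace =
      (1 + z + w + z * w * cexp (-(β * U))) ^ Fintype.card Λ := by
  convert trace_diagonal_fugacity_mul_exp_neg_onSiteSum_aux (Λ := Λ) β U z w using 6

/-- **The two-fugacity atomic limit, fused form**: for `z, w ≠ 0`,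
`tr exp( −β V_Λ(U,0) + diag(#↑·log z + #↓·log w) ) = (1 + z + w + z w e^{−βU})^{#Λ}`
(the reference `Zc₂(c = 0) = z₂^{#Λ}` of the two-fugacity polymer representation). -/
theorem trace_exp_neg_onSiteSum_add_logFugacity {inst : DecidableEq (Finset (Orb Λ))} (β U : ℂ) {z w : ℂ} (hz : z ≠ 0) (hw : w ≠ 0) :
    (NormedSpace.exp (-(β • onSiteSum U 0 (Finset.univ : Finset Λ)) + @diagonal _ ℂ inst _ fun s : Finset (Orb Λ) =>
        ((upPart s).card : ℂ) * Complex.log z + ((downPart s).card : ℂ) * Complex.log w)).trace =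
      (1 + z + w + z * w * cexp (-(β * U))) ^ Fintype.card Λ := by
  rw [← trace_diagonal_fugacity_mul_exp_neg_onSiteSum β U z w, ← neg_smul,
    trace_diagonal_fugacity_mul_exp_eq _ (preservesSectors_onSiteSum U 0 _) β hz hw]

end Atomic

end Summit.Ventures.CertifiedManyBodySolver.Theorems.TcThermcert1.ZeroFreeCorridor

end
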